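import Literature.AlgebraicGeometry.HodgeTheory.AlgebraicClassesCup
import Literature.AlgebraicGeometry.HodgeTheory.HardLefschetzNFold
import Literature.AlgebraicGeometry.Motives.ProjectiveDescentNormProofs
import Literature.AlgebraicGeometry.Motives.VarietiesQuasiCompactProofs
import HarnessLib

/-!
# `L(Nˡ H²ˡ) ⊆ N^{l+1} H^{2l+2}` for a class supported on every hypersurface section: the hyperplane moves (proved)

Family `hodge`, layer `Literature/AlgebraicGeometry/HodgeTheory`. Bottom-up proofs toward the named
facts `nonempty_hardLefschetzNFold n X` (file `HardLefschetzNFold`) and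
`hodgeIndex_primitiveAlgebraic n X` (file `HodgeIndexPrimitiveAlgebraic`): the field
`HardLefschetzNFold.lefschetzOperator_mem_algebraicClasses` — "`L = [H] ∪ ·` maps
`Nˡ H²ˡ(X(ℂ); ℂ)` into `N^{l+1} H^{2l+2}(X(ℂ); ℂ)`: `[Z] ↦ [H] ∪ [Z] = [H · Z]` for a codimension-`l`
cycle `Z` and `H` a hyperplane section containing no component of `Supp Z`" (Voisin II §9.2.4
Prop. 9.20 with a moved hyperplane; Fulton 1998 §19.2) — PROVED for every class `h ∈ H²(X(ℂ); ℂ)`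
which is supported on EVERY hypersurface section of a projective embedding `e : X ↪ ℙᴺ_ℂ` (i.e.
`h` dies on `(X ∖ X ∩ V₊(F))(ℂ)` for every form `F` of positive degree not vanishing identically on
`X`; intended: `h = [H] = c₁(𝒪_X(1))`, which is `(1/k) [X ∩ V₊(F)]` for `F` of degree `k`, so
vanishes off every hypersurface section — the shape in which the Chern–Weil / Fubini–Study side
delivers the hyperplane class, `ω_FS` being exact off `V₊(F)`).

The printed device is the remark recorded in the tree's `AlgebraicClassesCup`
(`cupProduct_mem_algebraicClasses_of_moving`, docstring): "For `l = 1` and `a = [H]` the class of a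
hyperplane section the hypothesis holds elementarily — `H` may be replaced by another hyperplane
section containing no component of `W` — which is the discharge route of the field
`HardLefschetzThreefold.lefschetzOperator_mem_algebraicClasses` via
`cupProduct_mem_supportedClasses_of_inter`." Here, for a closed `W ⊆ X` of codimension `≥ l`:

* `exists_hypersurfaceSection_forall_coheight` — there is a form `F` of positive degree, not
  vanishing identically on `X`, whose hypersurface section `X ∩ V₊(F)` meets `W` in codimension
  `≥ l + 1` everywhere: `W` has finitely many "generic points" of which all its points are
  specialisations (Noetherian sober space; `exists_finite_forall_exists_specializes`), graded
  prime avoidance (`Motives.GradedPrimeAvoidance.exists_posHomog_notMem`, Singh 2.9.2 / Bruns–Herzog 1.5.10)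
  gives a positive-degree form outside the finitely many relevant primes `𝔭_{e(g)}` (and outside
  `𝔭_{e(η_X)}`), and a point of `W ∩ V₊(F)` is then a STRICT specialisation of such a `g`, of
  codimension `≥ l + 1` (`add_one_le_coheight_of_specializes`, Hartshorne II Ex. 3.20).
* `lefschetzOperator_mem_algebraicClasses_of_forall_hypersurfaceSection` — hence `h ∪ c ∈
  N^{l+1} H^{2l+2}` for `c ∈ Nˡ H²ˡ` (the cup product with supports,
  `cupProduct_mem_supportedClasses_of_inter`, Fulton §19.2, PROVED in the tree), i.e. the field.
* `mem_algebraicClasses_one_of_forall_hypersurfaceSection` — and `h ∈ N¹ H²` itself (the field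
  `hyperplaneClass_mem`): `h` dies off the proper closed subset `X ∩ V₊(F)`, of codimension `≥ 1`.

No named fact is introduced (D-0026). What is NOT here: that `[H]` (or the transported Kähler class
of the restricted Fubini–Study metric) IS supported on every hypersurface section (Voisin I
Thm. 7.10, Thm. 11.33; Lelong–Poincaré) — the hypothesis `hsupp`.

## References

* [VoisinHodgeII2003] C. Voisin, Hodge Theory and Complex Algebraic Geometry II (CUP 2003), §9.2.4
  Prop. 9.20 and proof of Lemma 9.18 ("the class `[Z]` of a cycle `Z` vanishes on `X – Supp Z`").
* [Fulton1998] W. Fulton, Intersection Theory, 2nd ed. (Springer 1998), §19.2 Cor. 19.2.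
* [Hartshorne1977] R. Hartshorne, Algebraic Geometry (GTM 52, 1977), I Thm. 7.2 (projective
  dimension theorem), II Ex. 3.20, II Prop. 3.2.
* [Singh2011] B. Singh, Basic Commutative Algebra (World Scientific 2011), 2.9.2 (graded prime
  avoidance; also W. Bruns, J. Herzog, Cohen–Macaulay Rings, Lemma 1.5.10).
-/

noncomputable section

open CategoryTheory AlgebraicGeometry

namespace Literature.AlgebraicGeometry.HodgeTheory

section HodgeTheory

open Literature.AlgebraicTopology.SingularHomology Literature.Geometry.Kaehler

variable {n : ℕ} {X : Motives.SchemeOver ℂ}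

/-! ### Generic points and codimension (local copies) -/

/-- The total space of a smooth projective variety is a Noetherian topological space (finite type
over a field). Local copy of `noetherianSpace_of_isSmoothProjective` (file
`CorrespondenceSupportedVanishing`, not imported to keep the closure small).
[cite: Hartshorne1977, II Prop. 3.2 and II Ex. 2.13] -/
private theorem noetherianSpace_of_isSmoothProjective' (hX : Motives.IsSmoothProjective n X) :
    TopologicalSpace.NoetherianSpace ↥X.left := by
  haveI := Motives.IsSmoothProjective.isLocallyNoetherian_holds hX
  haveI := Motives.IsSmoothProjective.compactSpace_holds hX
  haveI : IsNoetherian X.left := {}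
  infer_instance

/-- In a Noetherian scheme, a closed subset `Z` contains a finite set of points (the generic
points of its irreducible components) of which every point of `Z` is a specialisation. Local copy
of `exists_finite_forall_exists_specializes` (file `AlgebraicClassesCupAbelianVariety`, not imported
to keep abelian varieties out of the closure). [cite: Hartshorne1977, II Ex. 3.20 and I Cor. 1.6] -/
private theorem exists_finite_forall_exists_specializes' [TopologicalSpace.NoetherianSpace ↥X.left]
    {Z : Set X.left} (hZ : IsClosed Z) :
    ∃ G : Set X.left, G.Finite ∧ G ⊆ Z ∧ ∀ x ∈ Z, ∃ g ∈ G, g ⤳ x := by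
  obtain ⟨S, hSf, hSc, hSi, hZS⟩ :=
    TopologicalSpace.NoetherianSpace.exists_finite_set_isClosed_irreducible hZ
  refine ⟨⋃ t ∈ S, {x | IsGenericPoint x t}, hSf.biUnion fun t _ ↦ ?_, ?_, ?_⟩
  · exact Set.Subsingleton.finite fun x hx y hy ↦ IsGenericPoint.eq hx hy
  · intro g hg
    simp only [Set.mem_iUnion, Set.mem_setOf_eq] at hg
    obtain ⟨t, ht, hgt⟩ := hg
    rw [hZS]
    exact Set.mem_sUnion_of_mem hgt.mem ht
  · intro x hx
    rw [hZS] at hx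
    obtain ⟨t, ht, hxt⟩ := Set.mem_sUnion.1 hx
    have hg := (hSi t ht).isGenericPoint_genericPoint (hSc t ht)
    exact ⟨(hSi t ht).genericPoint, Set.mem_biUnion ht hg, hg.specializes hxt⟩

/-- Strict specialisation raises the codimension: `g ⤳ x`, `g ≠ x`, `codim g ≥ l` ⟹
`codim x ≥ l + 1`. Local copy of `add_one_le_coheight_of_specializes` (file
`AlgebraicClassesCupAbelianVariety`). [cite: Hartshorne1977, II Ex. 3.20] -/
private theorem add_one_le_coheight_of_specializes' {g x : X.left} (h : g ⤳ x) (hne : g ≠ x)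
    {l : ℕ} (hl : (l : ℕ∞) ≤ Order.coheight g) : ((l + 1 : ℕ) : ℕ∞) ≤ Order.coheight x := by
  have hlt : x < g := by
    refine lt_of_le_not_ge (Scheme.le_iff_specializes.2 h) fun h' ↦ hne ?_
    exact (h.antisymm (Scheme.le_iff_specializes.1 h')).eq
  calc ((l + 1 : ℕ) : ℕ∞) = (l : ℕ∞) + 1 := by push_cast; rfl
    _ ≤ Order.coheight g + 1 := add_le_add hl le_rfl
    _ ≤ Order.coheight x := Order.coheight_add_one_le hlt

/-! ### A hypersurface section in general position with respect to a closed subset -/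

/-- **A hypersurface section meeting a given closed subset properly.** Let `X ⊂ ℙᴺ_ℂ` be smooth
projective (embedding `e`) and `W ⊆ X` Zariski-closed of codimension `≥ l` at every point. Then
there is a form `F` of some degree `k ≥ 1`, not vanishing identically on `X`
(`X ∩ V₊(F) ≠ X`), such that `X ∩ V₊(F)` meets `W` in codimension `≥ l + 1` at every point: choose
`F` outside the relevant primes of the finitely many generic points `g` of the components of `W`
and of the generic point of `X` (graded prime avoidance); a point `t ∈ W ∩ V₊(F)` specialises some
such `g ∉ V₊(F)`, strictly, so `codim t ≥ codim g + 1 ≥ l + 1` ("a hyperplane section containing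
no component of `W`"; the dimension count of Hartshorne I Thm. 7.2 in its easy direction).
[cite: Hartshorne1977, I Thm. 7.2 and II Ex. 3.20] [cite: Singh2011, 2.9.2 (graded prime avoidance)] -/
theorem exists_hypersurfaceSection_forall_coheight (hX : Motives.IsSmoothProjective n X)
    (e : Motives.ProjectiveEmbedding X) {W : Set X.left} (hW : IsClosed W) {l : ℕ}
    (hWl : ∀ w ∈ W, (l : ℕ∞) ≤ Order.coheight w) :
    ∃ (k : ℕ) (F : MvPolynomial (Fin (e.n + 1)) ℂ), 0 < k ∧ F.IsHomogeneous k ∧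
      e.ι.left.base ⁻¹' (letI := MvPolynomial.gradedAlgebra (σ := Fin (e.n + 1)) (R := ℂ);
        ProjectiveSpectrum.zeroLocus (MvPolynomial.homogeneousSubmodule (Fin (e.n + 1)) ℂ) {F}) ≠
          Set.univ ∧
      ∀ t ∈ e.ι.left.base ⁻¹' (letI := MvPolynomial.gradedAlgebra (σ := Fin (e.n + 1)) (R := ℂ);
          ProjectiveSpectrum.zeroLocus (MvPolynomial.homogeneousSubmodule (Fin (e.n + 1)) ℂ) {F}) ∩ W,
        ((l + 1 : ℕ) : ℕ∞) ≤ Order.coheight t := by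
  classical
  letI := MvPolynomial.gradedAlgebra (σ := Fin (e.n + 1)) (R := ℂ)
  haveI := noetherianSpace_of_isSmoothProjective' hX
  haveI : IrreducibleSpace X.left :=
    haveI := hX.geometricallyIrreducible
    GeometricallyIrreducible.irreducibleSpace_of_subsingleton X.hom
  -- finitely many points to avoid: the generic points of the components of `W`, and `η_X`
  obtain ⟨G, hGf, hGW, hGspec⟩ := exists_finite_forall_exists_specializes' hW
  set P : Set X.left := insert (genericPoint X.left) G with hP
  have hPf : P.Finite := hGf.insert _
  -- the relevant primes of their images in `ℙᴺ`
  let pt : X.left → ProjectiveSpectrum (MvPolynomial.homogeneousSubmodule (Fin (e.n + 1)) ℂ) :=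
    fun x ↦ e.ι.left.base x
  obtain ⟨F, ⟨k, hk, hFk, -⟩, hFP⟩ := Motives.GradedPrimeAvoidance.exists_posHomog_notMem
    (𝒜 := MvPolynomial.homogeneousSubmodule (Fin (e.n + 1)) ℂ)
    (I := (⊤ : Ideal (MvPolynomial (Fin (e.n + 1)) ℂ))) hPf.toFinset
    (fun x ↦ (pt x).asHomogeneousIdeal.toIdeal) (fun x _ ↦ (pt x).isPrime) (fun x _ ↦ by
      obtain ⟨a, ha, hax⟩ := Motives.GradedPrimeAvoidance.exists_posHomog_notMem_point
        (MvPolynomial.homogeneousSubmodule (Fin (e.n + 1)) ℂ) ⊤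
        (show Proj (MvPolynomial.homogeneousSubmodule (Fin (e.n + 1)) ℂ) from pt x)
        (fun hle ↦ (pt x).isPrime.ne_top (top_le_iff.mp (fun y
          (_ : y ∈ (⊤ : HomogeneousIdeal (MvPolynomial.homogeneousSubmodule (Fin (e.n + 1)) ℂ))) ↦
            hle (by trivial))))
      exact ⟨a, ha, hax⟩)
  have hFhom : F.IsHomogeneous k := (MvPolynomial.mem_homogeneousSubmodule k F).mp hFk
  -- membership in the section `X ∩ V₊(F)` is `F ∈ 𝔭_{e x}`
  have hmem : ∀ x : X.left, x ∈ e.ι.left.base ⁻¹'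
      ProjectiveSpectrum.zeroLocus (MvPolynomial.homogeneousSubmodule (Fin (e.n + 1)) ℂ) {F} ↔
      F ∈ (pt x).asHomogeneousIdeal := fun x ↦
    -- `x ∈ e⁻¹ V₊({F})` unfolds to `{F} ⊆ 𝔭_{e x}`
    ⟨fun h ↦ Set.singleton_subset_iff.mp h, fun h ↦ Set.singleton_subset_iff.mpr h⟩
  have hnot : ∀ x ∈ P, x ∉ e.ι.left.base ⁻¹'
      ProjectiveSpectrum.zeroLocus (MvPolynomial.homogeneousSubmodule (Fin (e.n + 1)) ℂ) {F} :=
    fun x hx h ↦ hFP x (hPf.mem_toFinset.2 hx) ((hmem x).1 h)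
  refine ⟨k, F, hk, hFhom, fun huniv ↦ ?_, fun t ht ↦ ?_⟩
  · exact hnot _ (Set.mem_insert _ _) (huniv ▸ Set.mem_univ _)
  · obtain ⟨g, hgG, hgt⟩ := hGspec t ht.2
    have hne : g ≠ t := fun hgt' ↦ hnot g (Set.mem_insert_of_mem _ hgG) (hgt' ▸ ht.1)
    exact add_one_le_coheight_of_specializes' hgt hne (hWl g (hGW hgG))

/-! ### The Lefschetz operator of a class supported on every hypersurface section -/

/-- **`L_h(Nˡ H²ˡ) ⊆ N^{l+1} H^{2l+2}` for a class `h` supported on every hypersurface section** (the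
field `HardLefschetzNFold.lefschetzOperator_mem_algebraicClasses` for such `h`; Voisin II Prop. 9.20
with a moved hyperplane: "`[H] ∪ [Z] = [H · Z]` for `H` a hyperplane section containing no
component of `Supp Z`"). If `h ∈ H²(X(ℂ); ℂ)` dies on `(X ∖ X ∩ V₊(F))(ℂ)` for every form `F` of
positive degree with `X ∩ V₊(F) ≠ X`, then for every `c ∈ Nˡ H²ˡ(X(ℂ); ℂ)`, `h ∪ c ∈ N^{l+1}`:
`c` is a sum of classes dying off closed `W` of codimension `≥ l`
(`supportedClasses_le`), a hypersurface section meets `W` in codimension `≥ l + 1`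
(`exists_hypersurfaceSection_forall_coheight`), and supports multiply
(`cupProduct_mem_supportedClasses_of_inter`). [cite: VoisinHodgeII2003, §9.2.4 Prop. 9.20]
[cite: Fulton1998, §19.2 Cor. 19.2] -/
theorem lefschetzOperator_mem_algebraicClasses_of_forall_hypersurfaceSection
    (hX : Motives.IsSmoothProjective n X) (e : Motives.ProjectiveEmbedding X) {h : complexBetti X 2}
    (hsupp : ∀ (k : ℕ) (F : MvPolynomial (Fin (e.n + 1)) ℂ), 0 < k → F.IsHomogeneous k →
      e.ι.left.base ⁻¹' (letI := MvPolynomial.gradedAlgebra (σ := Fin (e.n + 1)) (R := ℂ);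
        ProjectiveSpectrum.zeroLocus (MvPolynomial.homogeneousSubmodule (Fin (e.n + 1)) ℂ) {F}) ≠
          Set.univ →
      complexBetti.restrictCompl X (e.ι.left.base ⁻¹'
        (letI := MvPolynomial.gradedAlgebra (σ := Fin (e.n + 1)) (R := ℂ);
          ProjectiveSpectrum.zeroLocus (MvPolynomial.homogeneousSubmodule (Fin (e.n + 1)) ℂ) {F}))
        2 h = 0)
    (l : ℕ) (c : complexBetti X (2 * l)) (hc : c ∈ algebraicClasses X l) :
    lefschetzOperator h (two_add_two_mul l) c ∈ algebraicClasses X (l + 1) := by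
  classical
  letI := MvPolynomial.gradedAlgebra (σ := Fin (e.n + 1)) (R := ℂ)
  -- reduce to a class dying off one closed `W` of codimension `≥ l`
  suffices hle : algebraicClasses X l ≤
      (algebraicClasses X (l + 1)).comap (lefschetzOperator h (two_add_two_mul l)) from hle hc
  refine supportedClasses_le fun W hW hWl b hb ↦ ?_
  obtain ⟨k, F, hk, hF, huniv, hcodim⟩ := exists_hypersurfaceSection_forall_coheight hX e hW hWl
  have hZ : IsClosed (e.ι.left.base ⁻¹'
      ProjectiveSpectrum.zeroLocus (MvPolynomial.homogeneousSubmodule (Fin (e.n + 1)) ℂ) {F}) :=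
    (ProjectiveSpectrum.isClosed_zeroLocus _ _).preimage e.ι.left.continuous
  rw [Submodule.mem_comap, lefschetzOperator_apply]
  exact cupProduct_mem_supportedClasses_of_inter hZ hW hcodim _ (hsupp k F hk hF huniv)
    (LinearMap.mem_ker.mp hb)

/-- **A class supported on every hypersurface section lies in `N¹ H²`** (the field
`HardLefschetzNFold.hyperplaneClass_mem` for such `h`): `h` dies off `X ∩ V₊(F)` for a form `F` not
vanishing identically on `X`, a proper closed subset of the irreducible `X`, hence of codimension
`≥ 1` at each of its points (`exists_hypersurfaceSection_forall_coheight` with `W = X`, `l = 0`).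
[cite: VoisinHodgeII2003, proof of Lemma 9.18] -/
theorem mem_algebraicClasses_one_of_forall_hypersurfaceSection
    (hX : Motives.IsSmoothProjective n X) (e : Motives.ProjectiveEmbedding X) {h : complexBetti X 2}
    (hsupp : ∀ (k : ℕ) (F : MvPolynomial (Fin (e.n + 1)) ℂ), 0 < k → F.IsHomogeneous k →
      e.ι.left.base ⁻¹' (letI := MvPolynomial.gradedAlgebra (σ := Fin (e.n + 1)) (R := ℂ);
        ProjectiveSpectrum.zeroLocus (MvPolynomial.homogeneousSubmodule (Fin (e.n + 1)) ℂ) {F}) ≠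
          Set.univ →
      complexBetti.restrictCompl X (e.ι.left.base ⁻¹'
        (letI := MvPolynomial.gradedAlgebra (σ := Fin (e.n + 1)) (R := ℂ);
          ProjectiveSpectrum.zeroLocus (MvPolynomial.homogeneousSubmodule (Fin (e.n + 1)) ℂ) {F}))
        2 h = 0) :
    h ∈ algebraicClasses X 1 := by
  classical
  letI := MvPolynomial.gradedAlgebra (σ := Fin (e.n + 1)) (R := ℂ)
  obtain ⟨k, F, hk, hF, huniv, hcodim⟩ := exists_hypersurfaceSection_forall_coheight hX e
    isClosed_univ (l := 0) (fun w _ ↦ by simp)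
  have hZ : IsClosed (e.ι.left.base ⁻¹'
      ProjectiveSpectrum.zeroLocus (MvPolynomial.homogeneousSubmodule (Fin (e.n + 1)) ℂ) {F}) :=
    (ProjectiveSpectrum.isClosed_zeroLocus _ _).preimage e.ι.left.continuous
  exact mem_supportedClasses_of_restrictCompl_eq_zero hZ
    (fun z hz ↦ by exact_mod_cast hcodim z ⟨hz, Set.mem_univ z⟩) (hsupp k F hk hF huniv)

end HodgeTheory

end Literature.AlgebraicGeometry.HodgeTheory

end
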